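import Mathlib
import Summits.NavierStokesRegularity.NavierStokesRegularity.Theses.VortexLineClock
import Literature.Analysis.ODE.LipschitzFlow
import Literature.Analysis.ODE.FlowWithin
import Literature.Analysis.ODE.YorkePeriodBoundProofs
import HarnessLib

/-!
# `VortexLineClock.ProfileClockNoCycle` — the exact-profile clock theorem: an affine-commuting
  vorticity field has no closed vortex line (routes `VortexLineClock`, `RotatedEulerWindow`;
  item stmt-NavierStokesRegularity-11277, support; card P2)

**Statement.** Let `U, Ω ∈ C¹(ℝ³; ℝ³)` be globally Lipschitz, `γ ≠ −1`, and
`DΩ(y)[γ(y − c) + U(y)] − DU(y)[Ω(y)] = −Ω(y)` for all `y` (i.e. `[V, Ω] = −(1+γ)Ω` for the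
complete field `V = γ(y − c) + U`). Then `x' = Ω(x)` has no non-stationary periodic orbit.

PROOF. (1) THE FLOW TRANSPORTS `Ω` UP TO A SCALAR (`ProfileClock.fderiv_flow_apply_eq`): for a `C¹`
globally Lipschitz field `F` with `DΩ·F = DF·Ω + κΩ`, the global flow `Ψ` of `F`
(`Literature.Analysis.ODE.lipschitzFlow`) satisfies `DΨ_τ(x) Ω(x) = e^{−κτ} Ω(Ψ_τ x)` (`τ ≥ 0`):
`B(t) = Ω(Ψ_t x)` and `C(t) = e^{κt} J_t Ω(x)` — `J` the solution of the variational equation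
`J' = DF(Ψ_t x) ∘ J`, `J₀ = id`, which IS `DΨ_t(x)` (the tree's
`IsSolutionFamily.hasFDerivWithinAt`, Lang IV §1 Thm 1.14) — solve the same linear equation
`Y' = DF(Ψ_t x) Y + κY` with `Y(0) = Ω(x)`, hence coincide (`ODE_solution_unique_of_mem_Icc_right`).
(2) For `V` the constant is `κ = −(1+γ)`, for `−V` it is `1 + γ`; as `γ ≠ −1` one of them is
positive. With that field and `λ = e^{−κτ}`, a `p`-periodic orbit `x` of `Ω` yields the orbit
`w(σ) = Ψ_τ(x(σ/λ))` of `Ω` (chain rule + (1)) of period `λp`, non-stationary because `DΨ_τ` is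
injective (`Ψ_{−τ} ∘ Ψ_τ = id`). (3) YORKE (tree: `Yorke1969_periodBound_holds`): `p ≥ 2π/L`, so
`τ = log(Lp/π)/κ > 0` gives the period `λp = π/L < 2π/L` — contradiction. (`L = 0`: `Ω` is
constant and a periodic orbit forces `Ω(x 0) = 0`.)

References: J. A. Yorke, Proc. AMS 22 (1969) 509–512; S. Lang, *Differential and Riemannian
Manifolds* (1995), Ch. IV §1; Constantin–Ignatova–Vicol (putative 2026), §3.4.1 (the affine
structure `[V, Ω] = −(1+γ)Ω`).

HONEST FRAMING: an ODE statement about HYPOTHETICAL profile fields; nothing here bears on the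
regularity problem itself.
-/

noncomputable section

set_option linter.dupNamespace false

namespace Summit.NavierStokesRegularity.NavierStokesRegularity.Theorems

open Set Filter Topology Metric
open scoped NNReal
open Literature.Analysis.ODE

namespace ProfileClock

/-! ### (1) The flow transports an affinely commuting field up to a scalar -/

/-- **The flow of `F` transports `Ω` up to the factor `e^{−κτ}`**: for `F ∈ C¹` globally
Lipschitz, `Ω ∈ C¹` with `DΩ(y)F(y) = DF(y)Ω(y) + κΩ(y)`, the global flow `Ψ` of `F` satisfies
`DΨ_T(x) Ω(x) = e^{−κT} Ω(Ψ_T x)` for `T ≥ 0` (variational equation + uniqueness for the linear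
equation `Y' = DF(Ψ_t x)Y + κY`). [this file; Lang1995 Ch. IV §1 Thm 1.14] -/
theorem fderiv_flow_apply_eq {F Ω : (EuclideanSpace ℝ (Fin 3)) → (EuclideanSpace ℝ (Fin 3))} {K : ℝ≥0} (hK : LipschitzWith K F)
    (hF : ContDiff ℝ 1 F) (hΩ : ContDiff ℝ 1 Ω) {κ : ℝ}
    (hcomm : ∀ y, fderiv ℝ Ω y (F y) = fderiv ℝ F y (Ω y) + κ • Ω y)
    {T : ℝ} (hT : 0 ≤ T) (x : (EuclideanSpace ℝ (Fin 3))) :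
    fderiv ℝ (fun q => lipschitzFlow hK q T) x (Ω x) =
      Real.exp (-(κ * T)) • Ω (lipschitzFlow hK x T) := by
  set u : (EuclideanSpace ℝ (Fin 3)) → ℝ → (EuclideanSpace ℝ (Fin 3)) := lipschitzFlow hK with hu
  have hfam : IsSolutionFamily F univ univ T u :=
    ⟨fun y _ => lipschitzFlow_zero hK y,
      fun y _ τ _ => (hasDerivAt_lipschitzFlow hK y τ).hasDerivWithinAt, fun _ _ _ _ => mem_univ _⟩
  obtain ⟨J, hJ0, hJ⟩ := hfam.exists_linearization hT uniqueDiffOn_univ hF.contDiffOn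
  have hderiv : HasFDerivWithinAt (fun y' => u y' T) (J x T) univ x :=
    hfam.hasFDerivWithinAt hT convex_univ uniqueDiffOn_univ hF.contDiffOn (mem_univ x)
      (hJ0 x (mem_univ x)) (hJ x (mem_univ x)) ⟨hT, le_rfl⟩
  have hfd : fderiv ℝ (fun q => u q T) x = J x T :=
    (hderiv.hasFDerivAt univ_mem).fderiv
  -- the coefficient `A t = DF(Ψ_t x)` and its bound on `[0, T]`
  set A : ℝ → (EuclideanSpace ℝ (Fin 3)) →L[ℝ] (EuclideanSpace ℝ (Fin 3)) := fun t => fderiv ℝ F (u x t) with hA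
  have hJ' : ∀ t ∈ Icc 0 T, HasDerivWithinAt (J x) ((A t).comp (J x t)) (Icc 0 T) t := by
    intro t ht
    have h := hJ x (mem_univ x) t ht
    rwa [fderivWithin_univ] at h
  have hAcont : ContinuousOn A (Icc 0 T) :=
    ((hF.continuous_fderiv one_ne_zero).comp (continuous_lipschitzFlow hK x)).continuousOn
  obtain ⟨M, hM⟩ := isCompact_Icc.exists_bound_of_continuousOn hAcont
  have hM0 : 0 ≤ max M 0 := le_max_right _ _
  -- the linear field `v t w = A t w + κ w`, Lipschitz on `[0, T)`
  set v : ℝ → (EuclideanSpace ℝ (Fin 3)) → (EuclideanSpace ℝ (Fin 3)) := fun t w => A t w + κ • w with hv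
  set Kv : ℝ≥0 := ⟨max M 0 + |κ|, by positivity⟩ with hKv
  have hlip : ∀ t ∈ Ico 0 T, LipschitzOnWith Kv (v t) univ := by
    intro t ht
    refine LipschitzOnWith.of_dist_le_mul fun w _ w' _ => ?_
    rw [dist_eq_norm, dist_eq_norm]
    have e : v t w - v t w' = A t (w - w') + κ • (w - w') := by
      simp only [hv, map_sub, smul_sub]; abel
    rw [e]
    have h1 : ‖A t (w - w')‖ ≤ max M 0 * ‖w - w'‖ :=
      (ContinuousLinearMap.le_opNorm _ _).trans
        (mul_le_mul_of_nonneg_right ((hM t (Ico_subset_Icc_self ht)).trans (le_max_left _ _))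
          (norm_nonneg _))
    have h2 : ‖κ • (w - w')‖ = |κ| * ‖w - w'‖ := by rw [norm_smul, Real.norm_eq_abs]
    have hKv' : (Kv : ℝ) = max M 0 + |κ| := rfl
    calc ‖A t (w - w') + κ • (w - w')‖ ≤ ‖A t (w - w')‖ + ‖κ • (w - w')‖ := norm_add_le _ _
      _ ≤ max M 0 * ‖w - w'‖ + |κ| * ‖w - w'‖ := by rw [h2]; exact add_le_add h1 le_rfl
      _ = (Kv : ℝ) * ‖w - w'‖ := by rw [hKv']; ring
  -- `B t = Ω(Ψ_t x)` solves `B' = v t B`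
  set B : ℝ → (EuclideanSpace ℝ (Fin 3)) := fun t => Ω (u x t) with hB
  have hBd : ∀ t, HasDerivAt B (v t (B t)) t := by
    intro t
    have h1 : HasDerivAt (u x) (F (u x t)) t := hasDerivAt_lipschitzFlow hK x t
    have h2 : HasFDerivAt Ω (fderiv ℝ Ω (u x t)) (u x t) :=
      ((hΩ.differentiable one_ne_zero) _).hasFDerivAt
    have h3 := h2.comp_hasDerivAt t h1
    rw [hcomm] at h3
    exact h3
  -- `C t = e^{κt} J_t Ω(x)` solves `C' = v t C` within `[0, T]`
  set C : ℝ → (EuclideanSpace ℝ (Fin 3)) := fun t => Real.exp (κ * t) • J x t (Ω x) with hC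
  have hCd : ∀ t ∈ Ico 0 T, HasDerivWithinAt C (v t (C t)) (Ici t) t := by
    intro t ht
    have hJt : HasDerivWithinAt (J x) ((A t).comp (J x t)) (Ici t) t :=
      (hJ' t (Ico_subset_Icc_self ht)).mono_of_mem_nhdsWithin
        (mem_of_superset (Icc_mem_nhdsGE ht.2) (Icc_subset_Icc ht.1 le_rfl))
    have hJw : HasDerivWithinAt (fun s => J x s (Ω x)) ((A t).comp (J x t) (Ω x)) (Ici t) t := by
      have h := hJt.clm_apply (hasDerivWithinAt_const t (Ici t) (Ω x))
      simpa using h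
    have hexp : HasDerivWithinAt (fun s => Real.exp (κ * s)) (Real.exp (κ * t) * κ) (Ici t) t := by
      have h := (Real.hasDerivAt_exp (κ * t)).comp t ((hasDerivAt_id t).const_mul κ)
      simp only [mul_one] at h
      exact h.hasDerivWithinAt
    have h := hexp.smul hJw
    refine h.congr_deriv ?_
    simp only [hv, hC, ContinuousLinearMap.comp_apply, map_smul, smul_smul]
    module
  -- continuity of `C` on `[0, T]`
  have hCcont : ContinuousOn C (Icc 0 T) := by
    have hexpc : ContinuousOn (fun t : ℝ => Real.exp (κ * t)) (Icc 0 T) := by fun_prop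
    refine hexpc.smul ?_
    intro t ht
    exact ((hJ' t ht).continuousWithinAt).clm_apply continuousWithinAt_const
  -- uniqueness
  have h0 : B 0 = C 0 := by
    simp only [hB, hC, hu, lipschitzFlow_zero, mul_zero, Real.exp_zero, one_smul, hJ0 x (mem_univ x)]
    rfl
  have hBC : EqOn B C (Icc 0 T) :=
    ODE_solution_unique_of_mem_Icc_right hlip
      (fun t _ => (hBd t).continuousAt.continuousWithinAt)
      (fun t _ => (hBd t).hasDerivWithinAt) (fun _ _ => mem_univ _)
      hCcont hCd (fun _ _ => mem_univ _) h0
  have hTT := hBC ⟨hT, le_rfl⟩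
  simp only [hB, hC] at hTT
  rw [hfd, hTT, smul_smul, ← Real.exp_add, neg_add_cancel, Real.exp_zero, one_smul]

/-- The time-`t` map of the global flow is `C¹`, hence differentiable. [folklore] -/
theorem differentiable_flow {F : (EuclideanSpace ℝ (Fin 3)) → (EuclideanSpace ℝ (Fin 3))} {K : ℝ≥0} (hK : LipschitzWith K F)
    (hF : ContDiff ℝ 1 F) (t : ℝ) : Differentiable ℝ fun q => lipschitzFlow hK q t := by
  have h := contDiff_lipschitzFlow hF le_rfl hK
  have h2 : ContDiff ℝ 1 fun q : (EuclideanSpace ℝ (Fin 3)) => (q, t) := contDiff_id.prodMk contDiff_const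
  exact (h.comp h2).differentiable one_ne_zero

/-- **`DΨ_t(x)` is injective** (`Ψ_{−t} ∘ Ψ_t = id` and the chain rule). [folklore] -/
theorem fderiv_flow_injective {F : (EuclideanSpace ℝ (Fin 3)) → (EuclideanSpace ℝ (Fin 3))} {K : ℝ≥0} (hK : LipschitzWith K F)
    (hF : ContDiff ℝ 1 F) (t : ℝ) (x : (EuclideanSpace ℝ (Fin 3))) {w : (EuclideanSpace ℝ (Fin 3))}
    (hw : fderiv ℝ (fun q => lipschitzFlow hK q t) x w = 0) : w = 0 := by
  have hcomp : (fun q => lipschitzFlow hK (lipschitzFlow hK q t) (-t)) = id :=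
    funext fun q => lipschitzFlow_neg_lipschitzFlow hK q t
  have h1 : HasFDerivAt (fun q => lipschitzFlow hK q t)
      (fderiv ℝ (fun q => lipschitzFlow hK q t) x) x := (differentiable_flow hK hF t x).hasFDerivAt
  have h2 : HasFDerivAt (fun q => lipschitzFlow hK q (-t))
      (fderiv ℝ (fun q => lipschitzFlow hK q (-t)) (lipschitzFlow hK x t)) (lipschitzFlow hK x t) :=
    (differentiable_flow hK hF (-t) _).hasFDerivAt
  have h3 := h2.comp x h1
  have h4 : HasFDerivAt (fun q => lipschitzFlow hK (lipschitzFlow hK q t) (-t))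
      (ContinuousLinearMap.id ℝ (EuclideanSpace ℝ (Fin 3))) x := by
    rw [hcomp]; exact hasFDerivAt_id x
  have h5 := h3.unique h4
  have h6 := congrArg (fun L : (EuclideanSpace ℝ (Fin 3)) →L[ℝ] (EuclideanSpace ℝ (Fin 3)) => L w) h5
  simp only [ContinuousLinearMap.comp_apply, hw, map_zero, ContinuousLinearMap.id_apply] at h6
  exact h6.symm

/-! ### (2) Transporting a closed orbit and rescaling its period -/

/-- **A closed orbit of `Ω` is mapped by `Ψ_τ` to a closed orbit of `Ω` of period `e^{−κτ} p`**,
non-stationary if the original one is. [this file] -/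
theorem exists_orbit_scaled_period {F Ω : (EuclideanSpace ℝ (Fin 3)) → (EuclideanSpace ℝ (Fin 3))} {K : ℝ≥0} (hK : LipschitzWith K F)
    (hF : ContDiff ℝ 1 F) (hΩ : ContDiff ℝ 1 Ω) {κ : ℝ}
    (hcomm : ∀ y, fderiv ℝ Ω y (F y) = fderiv ℝ F y (Ω y) + κ • Ω y)
    {x : ℝ → (EuclideanSpace ℝ (Fin 3))} {p : ℝ} (hx : ∀ s, HasDerivAt x (Ω (x s)) s)
    (hper : ∀ s, x (s + p) = x s) (hΩ0 : Ω (x 0) ≠ 0) {τ : ℝ} (hτ : 0 ≤ τ) :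
    ∃ w : ℝ → (EuclideanSpace ℝ (Fin 3)), (∀ s, HasDerivAt w (Ω (w s)) s) ∧
      (∀ s, w (s + Real.exp (-(κ * τ)) * p) = w s) ∧ Ω (w 0) ≠ 0 := by
  set lam : ℝ := Real.exp (-(κ * τ)) with hlam
  have hlam0 : 0 < lam := Real.exp_pos _
  set Ψ : (EuclideanSpace ℝ (Fin 3)) → (EuclideanSpace ℝ (Fin 3)) := fun q => lipschitzFlow hK q τ with hΨ
  have hΨd : Differentiable ℝ Ψ := differentiable_flow hK hF τ
  have hkey : ∀ q, fderiv ℝ Ψ q (Ω q) = lam • Ω (Ψ q) := fun q =>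
    fderiv_flow_apply_eq hK hF hΩ hcomm hτ q
  refine ⟨fun s => Ψ (x (lam⁻¹ * s)), fun s => ?_, fun s => ?_, ?_⟩
  · -- chain rule
    have hlin : HasDerivAt (fun s : ℝ => lam⁻¹ * s) lam⁻¹ s := by
      simpa using (hasDerivAt_id s).const_mul lam⁻¹
    have h1 : HasDerivAt (fun s => x (lam⁻¹ * s)) (lam⁻¹ • Ω (x (lam⁻¹ * s))) s := by
      have h := (hx (lam⁻¹ * s)).scomp s hlin
      simpa only [Function.comp_def] using h
    have h2 := (hΨd (x (lam⁻¹ * s))).hasFDerivAt.comp_hasDerivAt s h1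
    have e : fderiv ℝ Ψ (x (lam⁻¹ * s)) (lam⁻¹ • Ω (x (lam⁻¹ * s))) = Ω (Ψ (x (lam⁻¹ * s))) := by
      rw [map_smul, hkey, smul_smul, inv_mul_cancel₀ hlam0.ne', one_smul]
    rw [e] at h2
    simpa only [Function.comp_def] using h2
  · show Ψ (x (lam⁻¹ * (s + lam * p))) = Ψ (x (lam⁻¹ * s))
    rw [mul_add, ← mul_assoc, inv_mul_cancel₀ hlam0.ne', one_mul, hper]
  · show Ω (Ψ (x (lam⁻¹ * 0))) ≠ 0
    rw [mul_zero]
    intro h0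
    have h1 : fderiv ℝ Ψ (x 0) (Ω (x 0)) = 0 := by rw [hkey, h0, smul_zero]
    exact hΩ0 (fderiv_flow_injective hK hF τ (x 0) h1)

end ProfileClock

open ProfileClock in
/-- **Item stmt-NavierStokesRegularity-11277** (`VortexLineClock.ProfileClockNoCycle`; the
EXACT-PROFILE CLOCK THEOREM): `U, Ω ∈ C¹` globally Lipschitz, `γ ≠ −1`,
`DΩ·(γ(y−c) + U) − DU·Ω = −Ω` ⇒ `x' = Ω(x)` has no non-stationary periodic orbit.
[this file; Yorke1969 + Lang1995 IV §1] -/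
theorem vortexLineClock_profileClockNoCycle_proof :
    Summit.NavierStokesRegularity.NavierStokesRegularity.Theses.VortexLineClock.ProfileClockNoCycle := by
  unfold Summit.NavierStokesRegularity.NavierStokesRegularity.Theses.VortexLineClock.ProfileClockNoCycle
  intro γ c U Ω hγ hU hΩ hLip hcomm
  rintro ⟨x, p, hp, hx, hper, hΩ0⟩
  obtain ⟨L, hLU, hLΩ⟩ := hLip
  -- Yorke for the given orbit
  have hY := Literature.Analysis.ODE.yorke1969_periodBound_fin3
    Literature.Analysis.ODE.Yorke1969_periodBound_holds
  -- the case `L = 0`: `Ω` is constant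
  by_cases hL0 : (L : ℝ) = 0
  · have hconst : ∀ a b, Ω a = Ω b := fun a b => by
      have h := hLΩ.dist_le_mul a b
      rw [hL0, zero_mul] at h
      exact dist_le_zero.1 h
    have hd : ∀ s, HasDerivAt (x - fun s : ℝ => s • Ω (x 0)) 0 s := fun s => by
      have h := (hx s).sub ((hasDerivAt_id s).smul_const (Ω (x 0)))
      simpa [hconst (x s) (x 0)] using h
    have hc := is_const_of_deriv_eq_zero (fun s => (hd s).differentiableAt) (fun s => (hd s).deriv) p 0
    simp only [Pi.sub_apply, zero_smul, sub_zero] at hc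
    have hp0 := hper 0
    rw [zero_add] at hp0
    rw [hp0, sub_eq_self, smul_eq_zero] at hc
    exact hc.elim (fun h => hp.ne' h) (fun h => hΩ0 h)
  have hLpos : 0 < (L : ℝ) := lt_of_le_of_ne L.2 (Ne.symm hL0)
  have hpY : 2 * Real.pi / L ≤ p := hY Ω L hLΩ x p hp hx hper hΩ0
  have hπL : 0 < Real.pi / L := div_pos Real.pi_pos hLpos
  have hp_ge : Real.pi / L < p := by
    have : Real.pi / L < 2 * Real.pi / L := by
      rw [div_lt_div_iff_of_pos_right hLpos]; linarith [Real.pi_pos]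
    exact this.trans_le hpY
  -- the complete field `V = γ(y − c) + U` and its negative
  set V : EuclideanSpace ℝ (Fin 3) → EuclideanSpace ℝ (Fin 3) := fun y => γ • (y - c) + U y with hV
  have hVaff : ∀ y, HasFDerivAt (fun y : EuclideanSpace ℝ (Fin 3) => γ • (y - c))
      (γ • ContinuousLinearMap.id ℝ (EuclideanSpace ℝ (Fin 3))) y := fun y =>
    ((hasFDerivAt_id y).sub_const c).const_smul γ
  have hUd : ∀ y, HasFDerivAt U (fderiv ℝ U y) y := fun y =>
    ((hU.differentiable one_ne_zero) y).hasFDerivAt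
  have hVd : ∀ y, HasFDerivAt V (γ • ContinuousLinearMap.id ℝ _ + fderiv ℝ U y) y := fun y =>
    (hVaff y).add (hUd y)
  have hfdV : ∀ y, fderiv ℝ V y = γ • ContinuousLinearMap.id ℝ _ + fderiv ℝ U y := fun y =>
    (hVd y).fderiv
  have hVC : ContDiff ℝ 1 V :=
    ((contDiff_id.sub contDiff_const).const_smul γ).add hU
  have hKaff : LipschitzWith ⟨|γ|, abs_nonneg γ⟩ (fun y : EuclideanSpace ℝ (Fin 3) => γ • (y - c)) :=
    LipschitzWith.of_dist_le_mul fun a b => by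
      rw [dist_eq_norm, dist_eq_norm, ← smul_sub, sub_sub_sub_cancel_right, norm_smul,
        Real.norm_eq_abs]
      rfl
  have hKV : LipschitzWith (⟨|γ|, abs_nonneg γ⟩ + L) V := hKaff.add hLU
  have hKnV : LipschitzWith (⟨|γ|, abs_nonneg γ⟩ + L) (fun y => -V y) := by
    have h := hKV.neg
    exact h
  have hnVC : ContDiff ℝ 1 (fun y => -V y) := hVC.neg
  have hfdnV : ∀ y, fderiv ℝ (fun y => -V y) y = -fderiv ℝ V y := fun y => (hVd y).neg.fderiv.trans (by rw [hfdV])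
  have hVap : ∀ y w, fderiv ℝ V y w = γ • w + fderiv ℝ U y w := fun y w => by
    rw [hfdV]; simp
  have hnVap : ∀ y w, fderiv ℝ (fun y => -V y) y w = -(fderiv ℝ V y w) := fun y w => by
    rw [hfdnV]; simp
  -- the commutators: `κ = −(1+γ)` for `V`, `κ = 1 + γ` for `−V`
  have hcommV : ∀ y, fderiv ℝ Ω y (V y) = fderiv ℝ V y (Ω y) + (-(1 + γ)) • Ω y := by
    intro y
    have h := hcomm y
    rw [sub_eq_iff_eq_add] at h
    rw [hVap, h]
    module
  have hcommnV : ∀ y, fderiv ℝ Ω y (-V y) = fderiv ℝ (fun y => -V y) y (Ω y) + (1 + γ) • Ω y := by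
    intro y
    rw [map_neg, hcommV y, hnVap, hVap]
    module
  -- pick the field whose constant `κ` is positive
  have hκ : ∃ (F : EuclideanSpace ℝ (Fin 3) → EuclideanSpace ℝ (Fin 3)) (κ : ℝ), 0 < κ ∧
      LipschitzWith (⟨|γ|, abs_nonneg γ⟩ + L) F ∧ ContDiff ℝ 1 F ∧
      ∀ y, fderiv ℝ Ω y (F y) = fderiv ℝ F y (Ω y) + κ • Ω y := by
    rcases lt_or_gt_of_ne hγ with h | h
    · exact ⟨V, -(1 + γ), by linarith, hKV, hVC, hcommV⟩
    · exact ⟨fun y => -V y, 1 + γ, by linarith, hKnV, hnVC, hcommnV⟩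
  obtain ⟨F, κ, hκpos, hKF, hFC, hcommF⟩ := hκ
  -- the transporting time `τ = log(L p / π) / κ > 0`: new period `π / L`
  set τ : ℝ := Real.log (L * p / Real.pi) / κ with hτ
  have hLpπ : 1 < L * p / Real.pi := by
    rw [lt_div_iff₀ Real.pi_pos, one_mul]
    have := (div_lt_iff₀ hLpos).1 hp_ge
    linarith
  have hτpos : 0 < τ := div_pos (Real.log_pos hLpπ) hκpos
  have hnew : Real.exp (-(κ * τ)) * p = Real.pi / L := by
    have e1 : κ * τ = Real.log (L * p / Real.pi) := by
      rw [hτ]; field_simp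
    rw [e1, Real.exp_neg, Real.exp_log (by positivity)]
    field_simp
  obtain ⟨w, hw, hwper, hw0⟩ :=
    exists_orbit_scaled_period hKF hFC hΩ hcommF hx hper hΩ0 hτpos.le
  rw [hnew] at hwper
  have hYw := hY Ω L hLΩ w (Real.pi / L) hπL hw hwper hw0
  -- `2π/L ≤ π/L` is absurd
  rw [div_le_div_iff_of_pos_right hLpos] at hYw
  linarith [Real.pi_pos]

end Summit.NavierStokesRegularity.NavierStokesRegularity.Theorems

end
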